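import Literature.NumberTheory.Irrationality.Zudilin2003.CatalanRemarksTheorem1
import HarnessLib

/-!
# Zudilin's Catalan sequence: the exact `2`-adic valuations, the sharp inclusions `2^{4n}u_n ∈ ℤ`,
# `2^{4n}D_{2n−1}²v_n ∈ ℤ`, and Krattenthaler–Rivoal's Theorems 1–2 — PROVED

Sources. [Zudilin2003Catalan] W. Zudilin, *An Apéry-like difference equation for Catalan's constant*, Electron. J.
Combin. 10 (2003) #R14 = arXiv:math/0201024, Sect. 4: "Our calculations show that `2^{4n}u_n ∈ ℤ` and
`2^{4n}D²_{2n−1}v_n ∈ ℤ` for `n ≤ 1000`" (an EXPERIMENTAL statement there); [KrattenthalerRivoal2008Catalan]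
C. Krattenthaler, T. Rivoal, *On a linear form for Catalan's constant*, South East Asian J. Math. Math. Sci. 6 (2008)
= arXiv:0810.1927, Theorems 1–2: `2^{4n}a_n ∈ ℤ`, `2^{4n}d²_{2n}b_n ∈ ℤ` (`a_n = −4u_n`, `b_n = −4v_n`), typed as the
named fact `Zudilin2003.krTheorems` (`CatalanRemarks.lean`); [Zudilin2002CatalanRemarks] Theorem 1, PROVED in
`CatalanRemarksTheorem1.lean` (`remarksTheorem1_holds`; odd part: `Remarks.v_int_odd_part`, `2^{6n+4}D²_{2n−1}v_n ∈ ℤ`).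

HONEST FRAMING (cell `pub-zeta5`): systematic search; no irrationality claim unless certified. These are
denominator statements about a known sequence of rational approximations to `G`; nothing diophantine follows.

WHAT IS PROVED HERE (cell pub-zeta5, lit seat gen 6; the `2`-adic half is an ELEMENTARY OBSERVATION OF THE CELL, not
taken from print): in the recursion (2), `q(n)` and `p(n)` are ODD, the extreme coefficients have `2`-adic
valuations `v₂((2n+1)²(2n+2)²p(n)) = 2 + 2v₂(n+1)` and `v₂((2n−1)²(2n)²p(n+1)) = 2 + 2v₂(n)`, and the two terms
`q(n)x_n`, `(2n−1)²(2n)²p(n+1)x_{n−1}` have DIFFERENT valuations all along both solutions; the ultrametric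
inequality therefore gives, by induction,
* `padicValRat_two_u` : `v₂(u_n) = −(2n + 2v₂(n!))` (`= 2s₂(n) − 4n`, `s₂` = binary digit sum), all `n`;
* `padicValRat_two_v` : `v₂(v_n) = −(2n + 1 + 2v₂(n!))` (`= 2s₂(n) − 4n − 1`), `n ≥ 1`.
With `v₂(n!) ≤ n − 1` and the odd part from [Zudilin2002CatalanRemarks, Thm 1] (`Remarks.v_int_odd_part`):
* `sharp_v_inclusion` : `2^{4n−1}·D²_{2n−1}·v_n ∈ ℤ` for `n ≥ 1`, hence `zudilin_observation` : `2^{4n}u_n ∈ ℤ` and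
  `2^{4n}D²_{2n−1}v_n ∈ ℤ` for ALL `n` — the experimental inclusions of [Zudilin2003Catalan, Sect. 4], PROVED;
* `krTheorems_holds : krTheorems` — [KrattenthalerRivoal2008Catalan, Theorems 1–2] DISCHARGED (they are weaker:
  `d_{2n} = lcm(1..2n) ⊇ D_{2n−1}` and `2^{4n+2} ⊇ 2^{4n−1}`); the printed proof uses Andrews' multidimensional
  ₈φ₇ transformation — here: [Zudilin2002CatalanRemarks, Thm 1] for the odd part + the `2`-adic induction.
Everything is PROVED (0 sorry, no new named facts; net: one named fact discharged).
-/

noncomputable section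

open Finset Filter

namespace Literature.NumberTheory.Irrationality.Zudilin2003

namespace TwoAdic

/-! ### `2`-adic valuations of the coefficients of the recursion (2) -/

/-- An odd integer has `2`-adic valuation `0` (as a rational). [cite: Zudilin2003Catalan, Sect. 1, eq. (2)–(3)] -/
theorem padicValRat_two_of_odd (z : ℤ) (hz : Odd z) : padicValRat 2 (z : ℚ) = 0 := by
  rw [padicValRat.of_int]
  have : ¬ (2 : ℤ) ∣ z := by
    rintro ⟨c, hc⟩
    obtain ⟨r, hr⟩ := hz
    omega
  simp [padicValInt.eq_zero_of_not_dvd this]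

/-- `v₂(2) = 1`. [folklore] -/
private theorem padicValRat_two_two : padicValRat 2 (2 : ℚ) = 1 := by
  simpa using (padicValRat.self (p := 2) one_lt_two)

/-- `q(n)` is odd, so `v₂(q(n)) = 0`. [cite: Zudilin2003Catalan, Sect. 1, eq. (3)] -/
theorem padicValRat_two_q (n : ℕ) : padicValRat 2 (q (n : ℚ)) = 0 := by
  have h : q (n : ℚ) = ((2 * (1760 * (n : ℤ) ^ 6 + 2816 * n ^ 5 + 1032 * n ^ 4 - 192 * n ^ 3 - 78 * n ^ 2
      + 8 * n) + 7 : ℤ) : ℚ) := by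
    unfold q; push_cast; ring
  rw [h]
  exact padicValRat_two_of_odd _
    ⟨1760 * (n : ℤ) ^ 6 + 2816 * n ^ 5 + 1032 * n ^ 4 - 192 * n ^ 3 - 78 * n ^ 2 + 8 * n + 3, by ring⟩

/-- `p(n)` is odd, so `v₂(p(n)) = 0`. [cite: Zudilin2003Catalan, Sect. 1, eq. (3)] -/
theorem padicValRat_two_p (n : ℤ) : padicValRat 2 (p (n : ℚ)) = 0 := by
  have h : p (n : ℚ) = ((2 * (10 * n ^ 2 - 4 * n) + 1 : ℤ) : ℚ) := by
    unfold p; push_cast; ring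
  rw [h]
  exact padicValRat_two_of_odd _ ⟨_, rfl⟩

/-- `v₂(2m) = 1 + v₂(m)` for `m ≥ 1` (as rationals). [folklore] -/
private theorem padicValRat_two_two_mul (m : ℕ) (hm : m ≠ 0) :
    padicValRat 2 ((2 * m : ℕ) : ℚ) = 1 + padicValNat 2 m := by
  rw [padicValRat.of_nat, padicValNat.mul (by norm_num) hm, padicValNat_self]
  push_cast
  ring

/-- The leading coefficient: `v₂((2n+1)²(2n+2)²p(n)) = 2 + 2v₂(n+1)`. [cite: Zudilin2003Catalan, Sect. 1, eq. (2)] -/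
theorem padicValRat_two_lead (n : ℕ) :
    padicValRat 2 ((2 * (n : ℚ) + 1) ^ 2 * (2 * (n : ℚ) + 2) ^ 2 * p (n : ℚ))
      = 2 + 2 * padicValNat 2 (n + 1) := by
  have h1 : (2 * (n : ℚ) + 1) ≠ 0 := by positivity
  have h2 : (2 * (n : ℚ) + 2) ≠ 0 := by positivity
  have h3 : p (n : ℚ) ≠ 0 := (p_pos (n : ℚ)).ne'
  rw [padicValRat.mul (mul_ne_zero (pow_ne_zero 2 h1) (pow_ne_zero 2 h2)) h3,
    padicValRat.mul (pow_ne_zero 2 h1) (pow_ne_zero 2 h2), padicValRat.pow, padicValRat.pow,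
    show (2 * (n : ℚ) + 1) = ((2 * (n : ℤ) + 1 : ℤ) : ℚ) by push_cast; ring,
    padicValRat_two_of_odd _ ⟨n, rfl⟩,
    show (2 * (n : ℚ) + 2) = ((2 * (n + 1) : ℕ) : ℚ) by push_cast; ring,
    padicValRat_two_two_mul (n + 1) (by omega),
    show (n : ℚ) = ((n : ℤ) : ℚ) by simp, padicValRat_two_p]
  push_cast
  ring

/-- The trailing coefficient: `v₂((2n−1)²(2n)²p(n+1)) = 2 + 2v₂(n)` (`n ≥ 1`). [cite: Zudilin2003Catalan, Sect. 1, eq. (2)] -/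
theorem padicValRat_two_tail (n : ℕ) (hn : 1 ≤ n) :
    padicValRat 2 ((2 * (n : ℚ) - 1) ^ 2 * (2 * (n : ℚ)) ^ 2 * p ((n : ℚ) + 1))
      = 2 + 2 * padicValNat 2 n := by
  have h1 : (2 * (n : ℚ) - 1) ≠ 0 := by
    have : (1 : ℚ) ≤ n := by exact_mod_cast hn
    linarith
  have h2 : (2 * (n : ℚ)) ≠ 0 := by
    have : (1 : ℚ) ≤ n := by exact_mod_cast hn
    positivity
  have h3 : p ((n : ℚ) + 1) ≠ 0 := (p_pos _).ne'
  rw [padicValRat.mul (mul_ne_zero (pow_ne_zero 2 h1) (pow_ne_zero 2 h2)) h3,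
    padicValRat.mul (pow_ne_zero 2 h1) (pow_ne_zero 2 h2), padicValRat.pow, padicValRat.pow,
    show (2 * (n : ℚ) - 1) = ((2 * ((n : ℤ) - 1) + 1 : ℤ) : ℚ) by push_cast; ring,
    padicValRat_two_of_odd _ ⟨(n : ℤ) - 1, rfl⟩,
    show (2 * (n : ℚ)) = ((2 * n : ℕ) : ℚ) by push_cast; ring,
    padicValRat_two_two_mul n (by omega),
    show (n : ℚ) + 1 = (((n : ℤ) + 1 : ℤ) : ℚ) by push_cast; ring, padicValRat_two_p]
  push_cast
  ring

/-! ### The ultrametric induction along the recursion -/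

/-- One step of the recursion (2) solved for `x_{n+1}`: if `x_{n−1}, x_n > 0` and
`v₂(x_n) < 2 + 2v₂(n) + v₂(x_{n−1})`, then `v₂(x_{n+1}) = v₂(x_n) − 2 − 2v₂(n+1)`.
[cite: Zudilin2003Catalan, Sect. 1, eq. (2)] -/
theorem step (x : ℕ → ℚ) (hx : IsSolution x) (n : ℕ) (hn : 1 ≤ n) (h0 : 0 < x (n - 1)) (h1 : 0 < x n)
    (hval : padicValRat 2 (x n) < 2 + 2 * padicValNat 2 n + padicValRat 2 (x (n - 1))) :
    padicValRat 2 (x (n + 1)) = padicValRat 2 (x n) - 2 - 2 * padicValNat 2 (n + 1) := by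
  have hrec := hx n hn
  set L := (2 * (n : ℚ) + 1) ^ 2 * (2 * (n : ℚ) + 2) ^ 2 * p (n : ℚ) with hL
  set T := (2 * (n : ℚ) - 1) ^ 2 * (2 * (n : ℚ)) ^ 2 * p ((n : ℚ) + 1) with hT
  have hLpos : 0 < L := lead_pos n
  have hTpos : 0 < T := by
    have : (1 : ℚ) ≤ n := by exact_mod_cast hn
    have hp := p_pos ((n : ℚ) + 1)
    have h1' : 0 < (2 * (n : ℚ) - 1) := by linarith
    positivity
  have hqpos : 0 < q (n : ℚ) := q_pos (by exact_mod_cast hn)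
  -- `x_{n+1} = (q x_n + T x_{n-1}) / L`
  have hx1 : x (n + 1) = (q (n : ℚ) * x n + T * x (n - 1)) / L := by
    rw [eq_div_iff hLpos.ne']
    linear_combination hrec
  have hA : padicValRat 2 (q (n : ℚ) * x n) = padicValRat 2 (x n) := by
    rw [padicValRat.mul hqpos.ne' h1.ne', padicValRat_two_q, zero_add]
  have hB : padicValRat 2 (T * x (n - 1)) = 2 + 2 * padicValNat 2 n + padicValRat 2 (x (n - 1)) := by
    rw [padicValRat.mul hTpos.ne' h0.ne', hT, padicValRat_two_tail n hn]
  have hsum : padicValRat 2 (q (n : ℚ) * x n + T * x (n - 1)) = padicValRat 2 (x n) := by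
    rw [padicValRat.add_eq_of_lt (by positivity) (by positivity) (by positivity) (by rw [hA, hB]; exact hval), hA]
  rw [hx1, padicValRat.div (by positivity) hLpos.ne', hsum, hL, padicValRat_two_lead]
  ring

/-- `v₂((n+1)!) = v₂(n!) + v₂(n+1)`. [folklore] -/
private theorem padicValNat_factorial_succ (n : ℕ) :
    padicValNat 2 (n + 1).factorial = padicValNat 2 n.factorial + padicValNat 2 (n + 1) := by
  rw [Nat.factorial_succ, padicValNat.mul (by omega) (Nat.factorial_ne_zero n), add_comm]

/-- **Exact `2`-adic valuation of `u_n`**: `v₂(u_n) = −(2n + 2v₂(n!)) = 2s₂(n) − 4n` for all `n` (the cell's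
elementary observation; in particular `2^{4n}u_n` is `2`-integral and `2^{4n}` is sharp exactly when `n` is a power
of `2`). [cite: Zudilin2003Catalan, Sect. 4 (the experimental inclusion `2^{4n}u_n ∈ ℤ`)] -/
theorem padicValRat_two_u (n : ℕ) :
    padicValRat 2 (u n) = -(2 * (n : ℤ) + 2 * padicValNat 2 n.factorial) := by
  -- two-step induction
  suffices H : ∀ n : ℕ, padicValRat 2 (u n) = -(2 * (n : ℤ) + 2 * padicValNat 2 n.factorial)
      ∧ padicValRat 2 (u (n + 1)) = -(2 * ((n : ℤ) + 1) + 2 * padicValNat 2 (n + 1).factorial) from (H n).1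
  intro n
  induction n with
  | zero =>
    refine ⟨by simp [u], ?_⟩
    show padicValRat 2 (sol 1 (7 / 4) 1) = _
    rw [sol_one, padicValRat.div (by norm_num) (by norm_num),
      show (7 : ℚ) = ((7 : ℤ) : ℚ) by norm_num, padicValRat_two_of_odd 7 ⟨3, by norm_num⟩,
      show (4 : ℚ) = (2 : ℚ) ^ 2 by norm_num, padicValRat.pow, padicValRat_two_two]
    simp
  | succ m ih =>
    obtain ⟨h0, h1⟩ := ih
    refine ⟨by simpa using h1, ?_⟩
    have hpos := fun k => (u_pos_and_v_succ_pos k).1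
    have hstep := step u (sol_isSolution 1 (7 / 4)) (m + 1) (by omega) (by simpa using hpos m) (hpos (m + 1))
      (by
        simp only [Nat.add_sub_cancel]
        rw [h0, h1, padicValNat_factorial_succ]
        omega)
    rw [show m + 1 + 1 = m + 2 by ring] at hstep
    rw [hstep, h1, show m + 2 = (m + 1) + 1 by ring, padicValNat_factorial_succ (m + 1)]
    push_cast
    ring

/-- **Exact `2`-adic valuation of `v_n`**: `v₂(v_n) = −(2n + 1 + 2v₂(n!)) = 2s₂(n) − 4n − 1` for `n ≥ 1`.
[cite: Zudilin2003Catalan, Sect. 4 (the experimental inclusion `2^{4n}D²_{2n−1}v_n ∈ ℤ`)] -/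
theorem padicValRat_two_v (n : ℕ) (hn : 1 ≤ n) :
    padicValRat 2 (v n) = -(2 * (n : ℤ) + 1 + 2 * padicValNat 2 n.factorial) := by
  suffices H : ∀ m : ℕ, padicValRat 2 (v (m + 1)) = -(2 * ((m : ℤ) + 1) + 1 + 2 * padicValNat 2 (m + 1).factorial)
      ∧ padicValRat 2 (v (m + 2)) = -(2 * ((m : ℤ) + 2) + 1 + 2 * padicValNat 2 (m + 2).factorial) by
    obtain ⟨m, rfl⟩ : ∃ m, n = m + 1 := ⟨n - 1, by omega⟩
    rw [(H m).1]
    push_cast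
    ring
  have hv1 : padicValRat 2 (v 1) = -3 := by
    show padicValRat 2 (sol 0 (13 / 8) 1) = _
    rw [sol_one, padicValRat.div (by norm_num) (by norm_num),
      show (13 : ℚ) = ((13 : ℤ) : ℚ) by norm_num, padicValRat_two_of_odd 13 ⟨6, by norm_num⟩,
      show (8 : ℚ) = (2 : ℚ) ^ 3 by norm_num, padicValRat.pow, padicValRat_two_two]
    simp
  intro m
  induction m with
  | zero =>
    refine ⟨by rw [hv1]; simp, ?_⟩
    -- `v₂ = q(1) v₁ / lead(1)` since `v₀ = 0`
    have hrec := sol_isSolution 0 (13 / 8) 1 le_rfl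
    have hv0 : v 0 = 0 := by simp [v]
    have hL : 0 < (2 * ((1 : ℕ) : ℚ) + 1) ^ 2 * (2 * ((1 : ℕ) : ℚ) + 2) ^ 2 * p ((1 : ℕ) : ℚ) := lead_pos 1
    have hv2 : v 2 = q ((1 : ℕ) : ℚ) * v 1 / ((2 * ((1 : ℕ) : ℚ) + 1) ^ 2 * (2 * ((1 : ℕ) : ℚ) + 2) ^ 2
        * p ((1 : ℕ) : ℚ)) := by
      rw [eq_div_iff hL.ne']
      have h := hrec
      simp only [Nat.sub_self, show (1 : ℕ) + 1 = 2 by rfl] at h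
      change _ * v 2 - _ * v 1 - _ * v 0 = 0 at h
      rw [hv0] at h
      linear_combination h
    have hv1pos : 0 < v 1 := v_pos le_rfl
    rw [hv2, padicValRat.div (mul_ne_zero (q_pos (by norm_num)).ne' hv1pos.ne') hL.ne',
      padicValRat.mul (q_pos (by norm_num)).ne' hv1pos.ne', padicValRat_two_q, hv1, padicValRat_two_lead]
    simp [Nat.factorial]
  | succ m ih =>
    obtain ⟨h0, h1⟩ := ih
    refine ⟨by push_cast at h1 ⊢; rw [h1]; ring, ?_⟩
    have hstep := step v (sol_isSolution 0 (13 / 8)) (m + 2) (by omega) (v_pos (by omega)) (v_pos (by omega))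
      (by
        rw [show m + 2 - 1 = m + 1 by omega, h0, h1, show m + 2 = (m + 1) + 1 by ring,
          padicValNat_factorial_succ (m + 1)]
        omega)
    rw [show m + 2 + 1 = m + 1 + 2 by ring] at hstep
    rw [hstep, h1, show m + 1 + 2 = (m + 2) + 1 by ring, padicValNat_factorial_succ (m + 2)]
    push_cast
    ring

/-! ### Integrality -/

/-- A rational `X/2^N` (`X ∈ ℤ`) with nonnegative `2`-adic valuation is an integer. [folklore] -/
private theorem int_of_padicValRat_nonneg (X : ℤ) (N : ℕ) (h : 0 ≤ padicValRat 2 ((X : ℚ) / 2 ^ N)) :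
    ∃ z : ℤ, (z : ℚ) = (X : ℚ) / 2 ^ N := by
  rcases eq_or_ne X 0 with hX | hX
  · exact ⟨0, by simp [hX]⟩
  have hv : padicValRat 2 ((X : ℚ) / 2 ^ N) = padicValInt 2 X - N := by
    rw [padicValRat.div (by exact_mod_cast hX) (by positivity), padicValRat.of_int, padicValRat.pow,
      padicValRat_two_two]
    ring
  rw [hv] at h
  have hdvd : (2 : ℤ) ^ N ∣ X := (padicValInt_dvd_iff N X).mpr (Or.inr (by exact_mod_cast (by linarith : (N : ℤ) ≤ padicValInt 2 X)))
  obtain ⟨z, hz⟩ := hdvd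
  refine ⟨z, ?_⟩
  rw [hz]
  push_cast
  field_simp

/-- **`2^{4n−1}·D²_{2n−1}·v_n ∈ ℤ` for `n ≥ 1`** (odd part: [Zudilin2002CatalanRemarks, Thm 1] via
`Remarks.v_int_odd_part`; `2`-part: `padicValRat_two_v` and `v₂(n!) ≤ n−1`). Sharper than both the experimental
`2^{4n}D²_{2n−1}` of [Zudilin2003Catalan, Sect. 4] and the proved `2^{4n+2}d²_{2n}` of
[KrattenthalerRivoal2008Catalan, Thm 2]. [cite: Zudilin2003Catalan, Sect. 4; KrattenthalerRivoal2008Catalan, Theorem 2] -/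
theorem sharp_v_inclusion (n : ℕ) (hn : 1 ≤ n) :
    ∃ z : ℤ, (z : ℚ) = 2 ^ (4 * n - 1) * (Nat.lcmUpto (2 * n - 1) : ℚ) ^ 2 * v n := by
  obtain ⟨X, hX⟩ := Remarks.v_int_odd_part n
  have hD : (0 : ℚ) < (Nat.lcmUpto (2 * n - 1) : ℚ) := by exact_mod_cast Nat.lcmUpto_pos _
  have hvpos : 0 < v n := v_pos hn
  have hy : 2 ^ (4 * n - 1) * (Nat.lcmUpto (2 * n - 1) : ℚ) ^ 2 * v n = (X : ℚ) / 2 ^ (2 * n + 5) := by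
    rw [eq_div_iff (by positivity), hX, show (2 : ℚ) ^ (6 * n + 4) = 2 ^ (4 * n - 1) * 2 ^ (2 * n + 5) by
      rw [← pow_add]; congr 1; omega]
    ring
  obtain ⟨z, hz⟩ := int_of_padicValRat_nonneg X (2 * n + 5) (by
    rw [← hy, padicValRat.mul (by positivity) hvpos.ne', padicValRat.mul (by positivity) (by positivity),
      padicValRat.pow, padicValRat_two_two, padicValRat.pow,
      show (Nat.lcmUpto (2 * n - 1) : ℚ) = ((Nat.lcmUpto (2 * n - 1) : ℕ) : ℚ) by rfl, padicValRat.of_nat,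
      padicValRat_two_v n hn]
    have hfac : padicValNat 2 n.factorial < n := padicValNat_factorial_lt_of_ne_zero (p := 2) (by omega)
    omega)
  exact ⟨z, by rw [hz, hy]⟩

/-- **Zudilin's experimental inclusions, PROVED for all `n`**: `2^{4n}u_n ∈ ℤ` and `2^{4n}D²_{2n−1}v_n ∈ ℤ`.
[cite: Zudilin2003Catalan, Sect. 4 ("our calculations show that … for n ≤ 1000")] -/
theorem zudilin_observation (n : ℕ) :
    (∃ z : ℤ, (z : ℚ) = 2 ^ (4 * n) * u n)
      ∧ (∃ z : ℤ, (z : ℚ) = 2 ^ (4 * n) * (Nat.lcmUpto (2 * n - 1) : ℚ) ^ 2 * v n) := by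
  refine ⟨KrattenthalerRivoal2008.theorem1 n, ?_⟩
  rcases Nat.eq_zero_or_pos n with rfl | hn
  · exact ⟨0, by simp [v]⟩
  · obtain ⟨z, hz⟩ := sharp_v_inclusion n hn
    refine ⟨2 * z, ?_⟩
    push_cast
    rw [hz, show (2 : ℚ) ^ (4 * n) = 2 * 2 ^ (4 * n - 1) by
      rw [← pow_succ']; congr 1; omega]
    ring

/-- `D_{2n−1} ∣ d_{2n}` (`lcm(1..2n−1) ∣ lcm(1..2n)`). [folklore] -/
private theorem lcmUpto_pred_dvd (n : ℕ) : Nat.lcmUpto (2 * n - 1) ∣ Nat.lcmUpto (2 * n) := by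
  unfold Nat.lcmUpto
  exact Finset.lcm_mono (Finset.Icc_subset_Icc_right (by omega))

end TwoAdic

open TwoAdic in
/-- **Theorems 1 and 2 of [KrattenthalerRivoal2008Catalan] — the named fact `krTheorems` DISCHARGED**: for every
`n ≥ 1`, `2^{4n+2}u_n ∈ ℤ` and `2^{4n+2}d²_{2n}v_n ∈ ℤ` (`a_n = −4u_n`, `b_n = −4v_n`).  Proof here: the `u`-half is
`KrattenthalerRivoal2008.theorem1` (Lemma 3 + Lemma 2 of the source, formalised); the `v`-half follows from the
sharper `2^{4n−1}D²_{2n−1}v_n ∈ ℤ` (`TwoAdic.sharp_v_inclusion`: [Zudilin2002CatalanRemarks, Thm 1] for the odd part,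
the cell's `2`-adic induction for the `2`-part) and `D_{2n−1} ∣ d_{2n}` — NOT the source's proof via Andrews'
multidimensional transformation. [cite: KrattenthalerRivoal2008Catalan, Theorem 1 and Theorem 2 (with (2.1)–(2.3))] -/
theorem krTheorems_holds : krTheorems := by
  intro n hn
  refine ⟨KrattenthalerRivoal2008.theorem1_printed n, ?_⟩
  obtain ⟨z, hz⟩ := TwoAdic.sharp_v_inclusion n hn
  obtain ⟨c, hc⟩ := TwoAdic.lcmUpto_pred_dvd n
  refine ⟨8 * (c : ℤ) ^ 2 * z, ?_⟩
  have hc' : (Nat.lcmUpto (2 * n) : ℚ) = (Nat.lcmUpto (2 * n - 1) : ℚ) * c := by exact_mod_cast hc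
  push_cast
  rw [hz, hc', show (2 : ℚ) ^ (4 * n + 2) = 8 * 2 ^ (4 * n - 1) by
    rw [show 4 * n + 2 = (4 * n - 1) + 3 by omega, pow_add]; ring]
  ring

end Literature.NumberTheory.Irrationality.Zudilin2003
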